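import Mathlib.Analysis.Convex.Function
import Mathlib.Analysis.Normed.Module.Convex
import Mathlib.Data.Fin.VecNotation
import Mathlib.Algebra.BigOperators.Fin
import Mathlib.Tactic
import HarnessLib

/-!
# Order conditions of explicit Runge–Kutta methods up to order four; the classical RK4, Kutta's 3/8-rule and the Shu–Osher SSP-RK3 tableaux; the SSP convexity mechanism

Topic `Analysis/ODE` (everything proved; no named fact). Companion of `Literature.Analysis.ODE.OneStepGlobalError`
(Hairer–Nørsett–Wanner I §II.3 Thm. 3.6: local error `≤ C h^{p+1}` + Lipschitz increment ⇒ global error `O(h^p)`).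

**Sources, as printed (held texts).** Hairer–Nørsett–Wanner, *Solving Ordinary Differential Equations I* (2nd ed.) §II.1:
the `s`-stage explicit method (1.8) `k_i = f(x₀ + c_i h, y₀ + h Σ_{j<i} a_ij k_j)`, `y₁ = y₀ + h Σ b_i k_i`; Kutta's convention
(1.9) `c_i = Σ_j a_ij`; order `p` ⟺ `‖y(x₀+h) − y₁‖ ≤ K h^{p+1}` (Def. 1.2); under (1.9) a 4-stage method has order 4 iff the
EIGHT conditions (1.11a)–(1.11h) hold (`Σ b_i = 1`, `Σ b_i c_i = 1/2`, `Σ b_i c_i² = 1/3`, `Σ b_i a_ij c_j = 1/6`, `Σ b_i c_i³ = 1/4`,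
`Σ b_i c_i a_ij c_j = 1/8`, `Σ b_i a_ij c_j² = 1/12`, `Σ b_i a_ij a_jk c_k = 1/24`); Lemma 1.3: under the simplifying assumption
(1.12) `Σ_i b_i a_ij = b_j(1 − c_j)` "the equations (d), (g), and (h) in (1.11) follow from the others"; Table 1.2: Kutta's
(1901) "The" Runge–Kutta method and 3/8-rule. §II.2 Thm. 2.13 (order `p` iff `Σ_j b_j Φ_j(t) = 1/γ(t)` for all rooted trees
of order `≤ p`; Table 2.3: 1, 2, 4, 8, 17 conditions for `p ≤ 5`); §II.5 Thm. 5.1 (`p ≥ 5`: no explicit method of order `p`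
with `s = p`). Gottlieb–Ketcheson–Shu (2011) §2.3: Butcher form (2.9) / Shu–Osher form (2.10); Thm. 2.1 ([Shu–Osher 1988,
§2]): forward Euler strongly stable (`‖u + Δt F(u)‖ ≤ ‖u‖`, `Δt ≤ Δt_FE`) and `α_ij, β_ij ≥ 0` ⇒ `‖u^{n+1}‖ ≤ ‖u^n‖` for
`Δt ≤ 𝒞 Δt_FE` ("each stage … a convex combination of forward Euler steps … by convexity of `‖·‖`"); §2.4.2 Thm. 2.3:
SSPRK(3,3) `u⁽¹⁾ = uⁿ + Δt L(uⁿ)`, `u⁽²⁾ = ¾uⁿ + ¼u⁽¹⁾ + ¼Δt L(u⁽¹⁾)`, `uⁿ⁺¹ = ⅓uⁿ + ⅔u⁽²⁾ + ⅔Δt L(u⁽²⁾)`, dictionary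
(2.18)–(2.19), `𝒞 = 1`, "only third order accurate".

**Formalised.** `Tableau s` with `IsExplicit`, `RowSum` (1.9), the order sums `q1 … q4d` (left sides of (1.11a–h)) and
`q5a = Σ b_i c_i⁴` (the order-5 'bushy tree' condition, `γ = 5`), `OrderConds3` / `OrderConds4` (the printed conjunctions), `Simplifying` (1.12).
LEMMA 1.3 FOR EVERY TABLEAU: under (1.12), `(d) = (b) − (c)`, `(g) = (c) − (e)`, `(h) = (d) − (f)` as identities of sums
(`q3b/q4c/q4d_eq_of_simplifying`, `orderConds4_of_simplifying`). THE TABLEAUX `rk4`, `kutta38`, `ssprk33` (Butcher form of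
SSPRK(3,3) by (2.19): `a₂₁ = 1`, `a₃₁ = a₃₂ = ¼`, `b = (1/6, 1/6, 2/3)`, `c = (0, 1, ½)`): explicit, Kutta row sums; `rk4`,
`kutta38` satisfy all eight order-4 conditions and violate the order-5 bushy-tree condition (`5/24`, `11/54 ≠ 1/5`) — with
Thm. 2.13 (cited, not formalised: B-series) their order is EXACTLY 4, as Thm. 5.1 demands; `rk4` satisfies (1.12);
`ssprk33` satisfies the four order-3 conditions and `Σ b c³ = 1/4`, but `Σ b_i c_i a_ij c_j = 1/12 ≠ 1/8` (order exactly 3).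
THE STEPS on a real vector space (`Tableau.step3/step4` = (1.8), autonomous `F`): `rk4_step4_eq_classical` (the tableau IS
`u + (h/6)(k₁ + 2k₂ + 2k₃ + k₄)`), `ssprk33ShuOsher_eq_step3` (the Shu–Osher form of Thm. 2.3 EQUALS the Butcher step of
`ssprk33` for every nonlinear `F` — (2.19) checked), the linear field `F = λ·` giving the stability polynomials
`Σ_{j≤4} zʲ/j!`, `Σ_{j≤3} zʲ/j!` (cf. `FluidComputer.RungeKuttaAdvection` on `ℂ`). THM. 2.1 FOR SSPRK(3,3) (`ssprk33_ssp`,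
`_norm`): for ANY convex functional `φ` (norm, seminorm, a convex 'total variation'), `φ(v + hF v) ≤ φ v ∀v` ⇒
`φ(SSPRK(3,3) u) ≤ φ u` at the SAME `h`.

Not formalised: the analytic content of Def. 1.2 / Thm. 2.13 (Taylor matching, independence of elementary differentials)
— below are the algebraic identities a tableau must satisfy and the exact algebra of the steps. Consumer: the `pub-fluidc`
cell's engines (dns-A, p1spec: `rk4`; dns-B: SSPRK(3,3) on the integrating-factor variable; HOME paper §B.2 / §P.2, and
§P.4's measured dt-halving slope 3.88 ≈ 4), beside `Literature.Analysis.FluidPDE.FluidComputer.RungeKuttaAdvection`.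
-/

noncomputable section

open Finset

namespace Literature.Analysis.ODE

namespace RungeKutta

variable {E : Type*} [AddCommGroup E] [Module ℝ E]

/-- The coefficient array of an `s`-stage Runge–Kutta method (1.8) — Butcher's tableau: matrix `a_ij`, weights `b_i`,
nodes `c_i`. [cite: HairerNorsettWanner1993, §II.1 Def. 1.1 eq. (1.8)] -/
structure Tableau (s : ℕ) where
  /-- the coefficients `a_ij` -/
  A : Fin s → Fin s → ℝ
  /-- the weights `b_i` -/
  b : Fin s → ℝ
  /-- the nodes `c_i` -/
  c : Fin s → ℝ

namespace Tableau

variable {s : ℕ} (t : Tableau s)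

/-- EXPLICIT (ERK, (1.8)): stage `i` uses only `k_j` with `j < i`, i.e. `a_ij = 0` for `i ≤ j`.
[cite: HairerNorsettWanner1993, §II.1 Def. 1.1 eq. (1.8)] -/
def IsExplicit : Prop := ∀ i j : Fin s, i ≤ j → t.A i j = 0

/-- Kutta's row-sum convention (1.9): `c_i = Σ_j a_ij` ("all points where `f` is evaluated are first order approximations
to the solution"). [cite: HairerNorsettWanner1993, §II.1 eq. (1.9)] -/
def RowSum : Prop := ∀ i : Fin s, t.c i = ∑ j, t.A i j

/-- Left side of (1.11a): `Σ_i b_i` (tree `τ`, `γ = 1`). [cite: HairerNorsettWanner1993, §II.1 eq. (1.11a)] -/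
def q1 : ℝ := ∑ i, t.b i

/-- Left side of (1.11b): `Σ_i b_i c_i` (`γ = 2`). [cite: HairerNorsettWanner1993, §II.1 eq. (1.11b)] -/
def q2 : ℝ := ∑ i, t.b i * t.c i

/-- Left side of (1.11c): `Σ_i b_i c_i²` (`γ = 3`). [cite: HairerNorsettWanner1993, §II.1 eq. (1.11c)] -/
def q3a : ℝ := ∑ i, t.b i * t.c i ^ 2

/-- Left side of (1.11d): `Σ_{i,j} b_i a_ij c_j` (`γ = 6`). [cite: HairerNorsettWanner1993, §II.1 eq. (1.11d)] -/
def q3b : ℝ := ∑ i, ∑ j, t.b i * t.A i j * t.c j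

/-- Left side of (1.11e): `Σ_i b_i c_i³` (`γ = 4`). [cite: HairerNorsettWanner1993, §II.1 eq. (1.11e)] -/
def q4a : ℝ := ∑ i, t.b i * t.c i ^ 3

/-- Left side of (1.11f): `Σ_{i,j} b_i c_i a_ij c_j` (`γ = 8`; the tree `t₄₂` of Table 2.2).
[cite: HairerNorsettWanner1993, §II.1 eq. (1.11f)] -/
def q4b : ℝ := ∑ i, ∑ j, t.b i * t.c i * t.A i j * t.c j

/-- Left side of (1.11g): `Σ_{i,j} b_i a_ij c_j²` (`γ = 12`). [cite: HairerNorsettWanner1993, §II.1 eq. (1.11g)] -/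
def q4c : ℝ := ∑ i, ∑ j, t.b i * t.A i j * t.c j ^ 2

/-- Left side of (1.11h): `Σ_{i,j,k} b_i a_ij a_jk c_k` (`γ = 24`). [cite: HairerNorsettWanner1993, §II.1 eq. (1.11h)] -/
def q4d : ℝ := ∑ i, ∑ j, ∑ k, t.b i * t.A i j * t.A j k * t.c k

/-- The order-5 condition attached to the 'bushy' tree of order 5: `Σ_i b_i c_i⁴` should equal `1/γ = 1/5` (one of the 17
conditions of order 5, Thm. 2.13 / Table 2.3). [cite: HairerNorsettWanner1993, §II.2 Thm. 2.13] -/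
def q5a : ℝ := ∑ i, t.b i * t.c i ^ 4

/-- Order-3 conditions (1.11a–d): `Σ b_i = 1`, `Σ b_i c_i = 1/2`, `Σ b_i c_i² = 1/3`, `Σ b_i a_ij c_j = 1/6` (1, 2, 4 conditions for
orders 1, 2, 3 — Table 2.3). [cite: HairerNorsettWanner1993, §II.1 eq. (1.11)] -/
def OrderConds3 : Prop := (t.q1 = 1 ∧ t.q2 = 1 / 2) ∧ t.q3a = 1 / 3 ∧ t.q3b = 1 / 6

/-- Order-4 conditions (1.11a–h) (eight conditions, Table 2.3): under (1.9) a 4-stage explicit method is of order 4 iff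
these hold. [cite: HairerNorsettWanner1993, §II.1 eq. (1.11)] -/
def OrderConds4 : Prop :=
  t.OrderConds3 ∧ t.q4a = 1 / 4 ∧ t.q4b = 1 / 8 ∧ t.q4c = 1 / 12 ∧ t.q4d = 1 / 24

/-- Butcher's simplifying assumption (1.12): `Σ_i b_i a_ij = b_j (1 − c_j)` for every `j`.
[cite: HairerNorsettWanner1993, §II.1 Lemma 1.3 eq. (1.12)] -/
def Simplifying : Prop := ∀ j : Fin s, ∑ i, t.b i * t.A i j = t.b j * (1 - t.c j)

/-! ### Lemma 1.3: under (1.12) the conditions (d), (g), (h) follow from the others — for every tableau -/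

/-- Under (1.12): `Σ_{i,j} b_i a_ij c_j = Σ_j b_j c_j − Σ_j b_j c_j²`, i.e. `(d) = (b) − (c)` as sums.
[cite: HairerNorsettWanner1993, §II.1 Lemma 1.3] -/
theorem q3b_eq_of_simplifying (hD : t.Simplifying) : t.q3b = t.q2 - t.q3a := by
  unfold q3b q2 q3a
  rw [Finset.sum_comm, ← Finset.sum_sub_distrib]
  refine Finset.sum_congr rfl fun j _ => ?_
  have e : ∑ i, t.b i * t.A i j * t.c j = (∑ i, t.b i * t.A i j) * t.c j := by rw [Finset.sum_mul]
  rw [e, hD j]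
  ring

/-- Under (1.12): `Σ_{i,j} b_i a_ij c_j² = Σ_j b_j c_j² − Σ_j b_j c_j³ = (c) − (e)` — the case demonstrated in the printed proof
("`= 1/3 − 1/4 = 1/12` by (c) and (e)"). [cite: HairerNorsettWanner1993, §II.1 Lemma 1.3] -/
theorem q4c_eq_of_simplifying (hD : t.Simplifying) : t.q4c = t.q3a - t.q4a := by
  unfold q4c q3a q4a
  rw [Finset.sum_comm, ← Finset.sum_sub_distrib]
  refine Finset.sum_congr rfl fun j _ => ?_
  have e : ∑ i, t.b i * t.A i j * t.c j ^ 2 = (∑ i, t.b i * t.A i j) * t.c j ^ 2 := by rw [Finset.sum_mul]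
  rw [e, hD j]
  ring

/-- Under (1.12): `Σ_{i,j,k} b_i a_ij a_jk c_k = Σ_{j,k} b_j a_jk c_k − Σ_{j,k} b_j c_j a_jk c_k = (d) − (f)`.
[cite: HairerNorsettWanner1993, §II.1 Lemma 1.3] -/
theorem q4d_eq_of_simplifying (hD : t.Simplifying) : t.q4d = t.q3b - t.q4b := by
  unfold q4d q3b q4b
  rw [Finset.sum_comm, ← Finset.sum_sub_distrib]
  refine Finset.sum_congr rfl fun j _ => ?_
  have e : ∑ i, ∑ k, t.b i * t.A i j * t.A j k * t.c k = (∑ i, t.b i * t.A i j) * ∑ k, t.A j k * t.c k := by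
    rw [Finset.sum_mul_sum]
    exact Finset.sum_congr rfl fun i _ => Finset.sum_congr rfl fun k _ => by ring
  rw [e, hD j, Finset.mul_sum, ← Finset.sum_sub_distrib]
  exact Finset.sum_congr rfl fun k _ => by ring

/-- Lemma 1.3 assembled: under (1.12), the five conditions (a), (b), (c), (e), (f) give (d) `= 1/2 − 1/3 = 1/6`,
(g) `= 1/3 − 1/4 = 1/12` ("by (c) and (e)"), (h) `= 1/6 − 1/8 = 1/24`, hence all eight order-4 conditions.
[cite: HairerNorsettWanner1993, §II.1 Lemma 1.3] -/
theorem orderConds4_of_simplifying (hD : t.Simplifying) (ha : t.q1 = 1) (hb : t.q2 = 1 / 2) (hc : t.q3a = 1 / 3)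
    (he : t.q4a = 1 / 4) (hf : t.q4b = 1 / 8) : t.OrderConds4 := by
  have hd : t.q3b = 1 / 6 := by rw [t.q3b_eq_of_simplifying hD, hb, hc]; norm_num
  have hg : t.q4c = 1 / 12 := by rw [t.q4c_eq_of_simplifying hD, hc, he]; norm_num
  have hh : t.q4d = 1 / 24 := by rw [t.q4d_eq_of_simplifying hD, hd, hf]; norm_num
  exact ⟨⟨⟨ha, hb⟩, hc, hd⟩, he, hf, hg, hh⟩

/-! ### The steps (1.8) on a real vector space, three and four stages, explicit -/

/-- The explicit three-stage step (1.8) for an autonomous field `F` on a real vector space: `k₁ = F u`,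
`k₂ = F(u + h a₂₁ k₁)`, `k₃ = F(u + h (a₃₁ k₁ + a₃₂ k₂))`, `u⁺ = u + h (b₁ k₁ + b₂ k₂ + b₃ k₃)` (only the sub-diagonal entries
are read). [cite: HairerNorsettWanner1993, §II.1 Def. 1.1 eq. (1.8)] -/
def step3 (t : Tableau 3) (F : E → E) (u : E) (h : ℝ) : E :=
  let k₁ := F u
  let k₂ := F (u + h • (t.A 1 0 • k₁))
  let k₃ := F (u + h • (t.A 2 0 • k₁ + t.A 2 1 • k₂))
  u + h • (t.b 0 • k₁ + t.b 1 • k₂ + t.b 2 • k₃)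

/-- The explicit four-stage step (1.8) for an autonomous field `F` on a real vector space.
[cite: HairerNorsettWanner1993, §II.1 Def. 1.1 eq. (1.8)] -/
def step4 (t : Tableau 4) (F : E → E) (u : E) (h : ℝ) : E :=
  let k₁ := F u
  let k₂ := F (u + h • (t.A 1 0 • k₁))
  let k₃ := F (u + h • (t.A 2 0 • k₁ + t.A 2 1 • k₂))
  let k₄ := F (u + h • (t.A 3 0 • k₁ + t.A 3 1 • k₂ + t.A 3 2 • k₃))
  u + h • (t.b 0 • k₁ + t.b 1 • k₂ + t.b 2 • k₃ + t.b 3 • k₄)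

end Tableau

/-! ### "The" Runge–Kutta method and Kutta's 3/8-rule (Table 1.2) -/

/-- "The" Runge–Kutta method of Kutta (1901), Table 1.2 (left): `c = (0, ½, ½, 1)`, `a₂₁ = ½`, `a₃₂ = ½`, `a₄₃ = 1` (all other
`a_ij = 0`), `b = (1/6, 2/6, 2/6, 1/6)` — case (3) of the classification with `w = 2/6` (Simpson's rule as quadrature).
[cite: HairerNorsettWanner1993, §II.1 Table 1.2] -/
def rk4 : Tableau 4 where
  A := ![![0, 0, 0, 0], ![1 / 2, 0, 0, 0], ![0, 1 / 2, 0, 0], ![0, 0, 1, 0]]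
  b := ![1 / 6, 2 / 6, 2 / 6, 1 / 6]
  c := ![0, 1 / 2, 1 / 2, 1]

/-- Kutta's 3/8-rule, Table 1.2 (right): `c = (0, ⅓, ⅔, 1)`, `a₂₁ = ⅓`, `a₃₁ = −⅓`, `a₃₂ = 1`, `a₄₁ = 1`, `a₄₂ = −1`, `a₄₃ = 1`,
`b = (1/8, 3/8, 3/8, 1/8)` — case (1) with `u = 1/3`, `v = 2/3` ("more precise", Kutta). [cite: HairerNorsettWanner1993, §II.1 Table 1.2] -/
def kutta38 : Tableau 4 where
  A := ![![0, 0, 0, 0], ![1 / 3, 0, 0, 0], ![-1 / 3, 1, 0, 0], ![1, -1, 1, 0]]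
  b := ![1 / 8, 3 / 8, 3 / 8, 1 / 8]
  c := ![0, 1 / 3, 2 / 3, 1]

/-- `rk4` is explicit. [cite: HairerNorsettWanner1993, §II.1 Table 1.2] -/
theorem rk4_isExplicit : rk4.IsExplicit := fun i j hij => by
  fin_cases i <;> fin_cases j <;> simp [rk4] at hij ⊢

/-- `rk4` obeys Kutta's row sums (1.9). [cite: HairerNorsettWanner1993, §II.1 Table 1.2] -/
theorem rk4_rowSum : rk4.RowSum := fun i => by
  fin_cases i <;> simp [rk4, Fin.sum_univ_four]

/-- "The" Runge–Kutta method satisfies ALL EIGHT order-4 conditions (1.11a)–(1.11h):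
`1, 1/2, 1/3, 1/6, 1/4, 1/8, 1/12, 1/24`. [cite: HairerNorsettWanner1993, §II.1 eq. (1.11) and Table 1.2] -/
theorem rk4_orderConds4 : rk4.OrderConds4 := by
  simp [Tableau.OrderConds4, Tableau.OrderConds3, Tableau.q1, Tableau.q2, Tableau.q3a, Tableau.q3b, Tableau.q4a,
    Tableau.q4b, Tableau.q4c, Tableau.q4d, rk4, Fin.sum_univ_four]
  norm_num

/-- `rk4` satisfies Butcher's simplifying assumption (1.12) (by Lemma 1.4 it must: for `s = 4`, (1.11) and (1.9) imply
(1.12)): `Σ_i b_i a_ij = b_j(1 − c_j) = 1/6, 1/6, 1/6, 0`. [cite: HairerNorsettWanner1993, §II.1 Lemma 1.4] -/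
theorem rk4_simplifying : rk4.Simplifying := by
  intro j
  fin_cases j
  all_goals simp [rk4, Fin.sum_univ_four]
  all_goals norm_num

/-- The order-5 bushy-tree condition FAILS for `rk4`: `Σ b_i c_i⁴ = 5/24 ≠ 1/5`. With Thm. 2.13 this makes the order EXACTLY 4 —
an instance of Thm. 5.1 (`p ≥ 5`: no explicit method of order `p` with `s = p` stages).
[cite: HairerNorsettWanner1993, §II.2 Thm. 2.13 and §II.5 Thm. 5.1] -/
theorem rk4_q5a : rk4.q5a = 5 / 24 ∧ rk4.q5a ≠ 1 / 5 := by
  have h : rk4.q5a = 5 / 24 := by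
    simp [Tableau.q5a, rk4, Fin.sum_univ_four]
    norm_num
  exact ⟨h, by rw [h]; norm_num⟩

/-- The 3/8-rule is explicit with Kutta's row sums. [cite: HairerNorsettWanner1993, §II.1 Table 1.2] -/
theorem kutta38_isExplicit_rowSum : kutta38.IsExplicit ∧ kutta38.RowSum := by
  refine ⟨fun i j hij => ?_, fun i => ?_⟩
  · fin_cases i <;> fin_cases j <;> simp [kutta38] at hij ⊢
  · fin_cases i
    all_goals simp [kutta38, Fin.sum_univ_four]
    all_goals norm_num

/-- The 3/8-rule satisfies all eight order-4 conditions (1.11a)–(1.11h). [cite: HairerNorsettWanner1993, §II.1 eq. (1.11) and Table 1.2] -/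
theorem kutta38_orderConds4 : kutta38.OrderConds4 := by
  simp [Tableau.OrderConds4, Tableau.OrderConds3, Tableau.q1, Tableau.q2, Tableau.q3a, Tableau.q3b, Tableau.q4a,
    Tableau.q4b, Tableau.q4c, Tableau.q4d, kutta38, Fin.sum_univ_four]
  norm_num

/-- The order-5 bushy-tree condition fails for the 3/8-rule too: `Σ b_i c_i⁴ = 11/54 ≠ 1/5` (order exactly 4, Thm. 5.1).
[cite: HairerNorsettWanner1993, §II.2 Thm. 2.13 and §II.5 Thm. 5.1] -/
theorem kutta38_q5a : kutta38.q5a = 11 / 54 ∧ kutta38.q5a ≠ 1 / 5 := by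
  have h : kutta38.q5a = 11 / 54 := by
    simp [Tableau.q5a, kutta38, Fin.sum_univ_four]
    norm_num
  exact ⟨h, by rw [h]; norm_num⟩

/-- THE TABLEAU IS THE TEXTBOOK FORMULA: for every field `F` on a real vector space, the `rk4` step (1.8) is
`u + (h/6)(k₁ + 2k₂ + 2k₃ + k₄)` with `k₁ = F u`, `k₂ = F(u + (h/2)k₁)`, `k₃ = F(u + (h/2)k₂)`, `k₄ = F(u + h k₃)`.
[cite: HairerNorsettWanner1993, §II.1 Table 1.2] -/
theorem rk4_step4_eq_classical (F : E → E) (u : E) (h : ℝ) :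
    rk4.step4 F u h =
      u + (h / 6) • (F u + (2 : ℝ) • F (u + (h / 2) • F u) + (2 : ℝ) • F (u + (h / 2) • F (u + (h / 2) • F u))
        + F (u + h • F (u + (h / 2) • F (u + (h / 2) • F u)))) := by
  obtain ⟨a10, a20, a21, a30, a31, a32⟩ : rk4.A 1 0 = 1 / 2 ∧ rk4.A 2 0 = 0 ∧ rk4.A 2 1 = 1 / 2 ∧ rk4.A 3 0 = 0 ∧
      rk4.A 3 1 = 0 ∧ rk4.A 3 2 = 1 := by simp [rk4]
  obtain ⟨b0, b1, b2, b3⟩ : rk4.b 0 = 1 / 6 ∧ rk4.b 1 = 2 / 6 ∧ rk4.b 2 = 2 / 6 ∧ rk4.b 3 = 1 / 6 := by simp [rk4]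
  have e2 : ∀ k : E, u + h • ((1 / 2 : ℝ) • k) = u + (h / 2) • k := fun k => by rw [smul_smul]; ring_nf
  have e3 : ∀ k k' : E, u + h • ((0 : ℝ) • k + (1 / 2 : ℝ) • k') = u + (h / 2) • k' := fun k k' => by
    rw [zero_smul, zero_add, smul_smul]; ring_nf
  have e4 : ∀ k k' k'' : E, u + h • ((0 : ℝ) • k + (0 : ℝ) • k' + (1 : ℝ) • k'') = u + h • k'' := fun k k' k'' => by
    rw [zero_smul, zero_smul, zero_add, zero_add, one_smul]
  simp only [Tableau.step4, a10, a20, a21, a30, a31, a32, b0, b1, b2, b3, e2, e3, e4]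
  module

/-- On the linear field `F = λ·` the `rk4` step is multiplication by the stability polynomial
`R₄(z) = 1 + z + z²/2 + z³/6 + z⁴/24`, `z = hλ` (cf. `RungeKutta.rk4Step_linear` on `ℂ` in `FluidComputer.RungeKuttaAdvection`).
[cite: HairerNorsettWanner1993, §II.1 Table 1.2] -/
theorem rk4_step4_linear (lam h : ℝ) (u : E) :
    rk4.step4 (fun v => lam • v) u h =
      (1 + h * lam + (h * lam) ^ 2 / 2 + (h * lam) ^ 3 / 6 + (h * lam) ^ 4 / 24) • u := by
  rw [rk4_step4_eq_classical]
  module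

/-! ### SSPRK(3,3): Butcher form (2.19), Shu–Osher form (Thm. 2.3), order exactly 3, and the SSP mechanism (Thm. 2.1) -/

/-- The Butcher tableau of the Shu–Osher method SSPRK(3,3), obtained from its Shu–Osher coefficients
(`α₁₀ = β₁₀ = 1`; `α₂₀ = ¾`, `α₂₁ = β₂₁ = ¼`; `α₃₀ = ⅓`, `α₃₂ = β₃₂ = ⅔`) by the dictionary (2.19): `a₂₁ = 1`, `a₃₁ = a₃₂ = ¼`,
`b = (1/6, 1/6, 2/3)`, nodes `c = (0, 1, ½)` by (1.9). [cite: GottliebKetchesonShu2011, §2.4.2 Thm. 2.3 eqs. (2.18)–(2.19)] -/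
def ssprk33 : Tableau 3 where
  A := ![![0, 0, 0], ![1, 0, 0], ![1 / 4, 1 / 4, 0]]
  b := ![1 / 6, 1 / 6, 2 / 3]
  c := ![0, 1, 1 / 2]

/-- SSPRK(3,3) in the Shu–Osher form of Thm. 2.3, on a real vector space, for a field `F`:
`u₁ = u + h F u`, `u₂ = ¾u + ¼(u₁ + h F u₁)`, `u⁺ = ⅓u + ⅔(u₂ + h F u₂)`.
[cite: GottliebKetchesonShu2011, §2.4.2 Thm. 2.3 (SSPRK(3,3))] -/
def ssprk33ShuOsher (F : E → E) (u : E) (h : ℝ) : E :=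
  let u₁ := u + h • F u
  let u₂ := (3 / 4 : ℝ) • u + (1 / 4 : ℝ) • (u₁ + h • F u₁)
  (1 / 3 : ℝ) • u + (2 / 3 : ℝ) • (u₂ + h • F u₂)

/-- `ssprk33` is explicit with Kutta's row sums (`c = (0, 1, ½)`). [cite: GottliebKetchesonShu2011, §2.4.2 eq. (2.18)] -/
theorem ssprk33_isExplicit_rowSum : ssprk33.IsExplicit ∧ ssprk33.RowSum := by
  refine ⟨fun i j hij => ?_, fun i => ?_⟩
  · fin_cases i <;> fin_cases j <;> simp [ssprk33] at hij ⊢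
  · fin_cases i
    all_goals simp [ssprk33, Fin.sum_univ_three]
    all_goals norm_num

/-- SSPRK(3,3) satisfies the four ORDER-3 conditions (1.11a)–(1.11d): `1, 1/2, 1/3, 1/6` ("third order accurate").
[cite: GottliebKetchesonShu2011, §2.4.2 Thm. 2.3] -/
theorem ssprk33_orderConds3 : ssprk33.OrderConds3 := by
  simp [Tableau.OrderConds3, Tableau.q1, Tableau.q2, Tableau.q3a, Tableau.q3b, ssprk33, Fin.sum_univ_three]
  norm_num

/-- … and NOT the order-4 conditions: `Σ b_i c_i³ = 1/4` happens to hold, but `Σ b_i c_i a_ij c_j = 1/12 ≠ 1/8` (condition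
(1.11f) fails) — order exactly 3 ("only third order accurate"). [cite: GottliebKetchesonShu2011, §2.4.2 (after Thm. 2.3)] -/
theorem ssprk33_not_order4 : ssprk33.q4a = 1 / 4 ∧ ssprk33.q4b = 1 / 12 ∧ ¬ ssprk33.OrderConds4 := by
  have h4a : ssprk33.q4a = 1 / 4 := by
    simp [Tableau.q4a, ssprk33, Fin.sum_univ_three]
    norm_num
  have h4b : ssprk33.q4b = 1 / 12 := by
    simp [Tableau.q4b, ssprk33, Fin.sum_univ_three]
    norm_num
  refine ⟨h4a, h4b, fun hoc => ?_⟩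
  have := hoc.2.2.1
  rw [h4b] at this
  norm_num at this

/-- THE DICTIONARY (2.19) CHECKED: for every field `F` on a real vector space and every `u, h`, the Shu–Osher form of
SSPRK(3,3) equals the Butcher step (1.8) of the tableau `ssprk33` — the intermediate Shu–Osher stage `¾u + ¼(u₁ + hF u₁)`
is the Butcher point `u + h(¼k₁ + ¼k₂)`. [cite: GottliebKetchesonShu2011, §2.4.2 eqs. (2.18)–(2.19)] -/
theorem ssprk33ShuOsher_eq_step3 (F : E → E) (u : E) (h : ℝ) :
    ssprk33ShuOsher F u h = ssprk33.step3 F u h := by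
  obtain ⟨a10, a20, a21, b0, b1, b2⟩ : ssprk33.A 1 0 = 1 ∧ ssprk33.A 2 0 = 1 / 4 ∧ ssprk33.A 2 1 = 1 / 4 ∧
      ssprk33.b 0 = 1 / 6 ∧ ssprk33.b 1 = 1 / 6 ∧ ssprk33.b 2 = 2 / 3 := by simp [ssprk33]
  have stage2 : (3 / 4 : ℝ) • u + (1 / 4 : ℝ) • (u + h • F u + h • F (u + h • F u)) =
      u + h • ((1 / 4 : ℝ) • F u + (1 / 4 : ℝ) • F (u + h • F u)) := by
    module
  simp only [ssprk33ShuOsher, Tableau.step3, a10, a20, a21, b0, b1, b2, one_smul]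
  rw [stage2]
  module

/-- On the linear field `F = λ·` the SSPRK(3,3) step is multiplication by `R₃(z) = 1 + z + z²/2 + z³/6`, `z = hλ` — the
stability polynomial of every three-stage third-order method (cf. `RungeKutta.ssprk3Step_linear` on `ℂ` in
`FluidComputer.RungeKuttaAdvection`). [cite: GottliebKetchesonShu2011, §2.4.2 Thm. 2.3] -/
theorem ssprk33_step3_linear (lam h : ℝ) (u : E) :
    ssprk33ShuOsher (fun v => lam • v) u h = (1 + h * lam + (h * lam) ^ 2 / 2 + (h * lam) ^ 3 / 6) • u := by
  simp only [ssprk33ShuOsher]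
  module

/-- THM. 2.1 FOR SSPRK(3,3) (SSP COEFFICIENT `𝒞 = 1`): let `φ` be ANY convex functional on the real vector space `E`. If the
forward-Euler map at step `h` does not increase `φ` — `φ(v + h F v) ≤ φ(v)` for every `v` — then one SSPRK(3,3) step at the
SAME `h` does not increase `φ` either. The printed proof verbatim: each Shu–Osher stage is a convex combination
(`¾,¼` and `⅓,⅔`) of previous stages and forward-Euler steps. [cite: GottliebKetchesonShu2011, §2.3 Thm. 2.1 and §2.4.2 Thm. 2.3] -/
theorem ssprk33_ssp {φ : E → ℝ} (hφ : ConvexOn ℝ Set.univ φ) {F : E → E} {h : ℝ}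
    (hFE : ∀ v : E, φ (v + h • F v) ≤ φ v) (u : E) : φ (ssprk33ShuOsher F u h) ≤ φ u := by
  have cvx : ∀ (x y : E) (a b : ℝ), 0 ≤ a → 0 ≤ b → a + b = 1 → φ (a • x + b • y) ≤ a * φ x + b * φ y := by
    intro x y a b ha hb hab
    simpa [smul_eq_mul] using hφ.2 (Set.mem_univ x) (Set.mem_univ y) ha hb hab
  simp only [ssprk33ShuOsher]
  set u₁ := u + h • F u with hu₁
  set u₂ := (3 / 4 : ℝ) • u + (1 / 4 : ℝ) • (u₁ + h • F u₁) with hu₂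
  have h₁ : φ u₁ ≤ φ u := hFE u
  have h₂ : φ u₂ ≤ φ u :=
    calc φ u₂ ≤ 3 / 4 * φ u + 1 / 4 * φ (u₁ + h • F u₁) :=
          cvx _ _ _ _ (by norm_num) (by norm_num) (by norm_num)
      _ ≤ 3 / 4 * φ u + 1 / 4 * φ u₁ := by gcongr; exact hFE u₁
      _ ≤ φ u := by linarith
  calc φ ((1 / 3 : ℝ) • u + (2 / 3 : ℝ) • (u₂ + h • F u₂)) ≤ 1 / 3 * φ u + 2 / 3 * φ (u₂ + h • F u₂) :=
        cvx _ _ _ _ (by norm_num) (by norm_num) (by norm_num)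
    _ ≤ 1 / 3 * φ u + 2 / 3 * φ u₂ := by gcongr; exact hFE u₂
    _ ≤ φ u := by linarith

/-- Thm. 2.1 for SSPRK(3,3) with `φ = ‖·‖` on a real normed space: `‖u + hF u‖ ≤ ‖u‖` for all `u` implies
`‖SSPRK(3,3)(u)‖ ≤ ‖u‖` — "the strong stability bound `‖uⁿ⁺¹‖ ≤ ‖uⁿ‖` under `Δt ≤ 𝒞 Δt_FE`", `𝒞 = 1`.
[cite: GottliebKetchesonShu2011, §2.3 Thm. 2.1] -/
theorem ssprk33_ssp_norm {V : Type*} [NormedAddCommGroup V] [NormedSpace ℝ V] {F : V → V} {h : ℝ}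
    (hFE : ∀ v : V, ‖v + h • F v‖ ≤ ‖v‖) (u : V) : ‖ssprk33ShuOsher F u h‖ ≤ ‖u‖ :=
  ssprk33_ssp convexOn_univ_norm hFE u

end RungeKutta

end Literature.Analysis.ODE

end
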